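import Mathlib
import Summits.Ventures.PercRepro2.TypedOBehindA3

/-!
# Pocket classes I: two vanishing placements at a marked cut vertex (blind cell PercRepro2,
p3 g3, 2026-08-25; `proofs/P3-BRIDGE.md` §11.18)

Cut-vertex sufficient conditions, through the closure lemmas `conn_side` / `conn_cross` of
`RootCutSupport`, for two exact zeros of the typed bases:
* **`a₃` as the cut vertex** — `o` on one side of `a₃`, both roots on the other: the instance has
  `o` behind `a₃` (`OBehindA3.of_cut`), so every typed base vanishes (`typedCount_eq_zero_of_a3_cut`,
  from `TypedOBehindA3.lean`);
* **the root pocket** — the marks reach `a₁` only through `a₂` (`RootPocket`; e.g. `a₂` a cut vertex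
  between `a₁` and every mark, `RootPocket.of_cut`): every typed base vanishes
  (`typedCount_eq_zero_of_rootPocket`; the symmetrised kernel is identically zero on the 16 valid
  states with «a mark at `a₁` forces `a₁ ↔ a₂`», `decide`).
The mark pocket (`o, b, a₃` behind an unmarked cut vertex) is row 2′TRI by `typedCount_nonneg_of_uncrossed`
(`TypedPocketClasses.lean`, filed on the olean of `TypedUncrossed.lean`).  Own work; standard axioms.
-/

namespace Summit.Ventures.PercRepro2

open UnionCluster

namespace CovForm

namespace RootBridge

open OneTyped TypedA3 Untouched TypedFactor Separated

section Pockets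

open Classical

variable {V : Type*} {E : Type*} [Fintype E] [DecidableEq E] {R : Type*} [Field R]
  [LinearOrder R] [IsStrictOrderedRing R]
variable (ends : E → Sym2 V) (o a₁ a₂ a₃ b c : V)

omit [Fintype E] in
/-- A configuration below `z ∪ F` has its open edges within a side. -/
lemma split_of_le_zF {VL VH : Set V} {F : Finset E} {z : Config E}
    (hsplit : ∀ e, zF F z e = true → e ∈ within ends VL ∨ e ∈ within ends VH) {x : Config E}
    (hx : x ≤ zF F z) : ∀ e, x e = true → e ∈ within ends VL ∨ e ∈ within ends VH := fun e he =>
  hsplit e (by have := hx e; rw [he] at this; exact Bool.eq_true_of_true_le this)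

omit [Fintype E] in
/-- **`a₃` as a cut vertex between `o` and the roots** puts `o` behind `a₃`. -/
theorem OBehindA3.of_cut {VL VH : Set V} {F : Finset E} {z : Config E}
    (hsplit : ∀ e, zF F z e = true → e ∈ within ends VL ∨ e ∈ within ends VH)
    (hcap : ∀ t, t ∈ VL → t ∈ VH → t = a₃) (ha3L : a₃ ∈ VL) (ha3H : a₃ ∈ VH) (hoL : o ∈ VL)
    (ha1H : a₁ ∈ VH) (ha2H : a₂ ∈ VH) (hoa3 : o ≠ a₃) : OBehindA3 ends o a₁ a₂ a₃ F z := by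
  refine ⟨fun x hx => ?_⟩
  have hsp : ∀ e, x e = true → e ∈ within ends VH ∨ e ∈ within ends VL := fun e he =>
    (split_of_le_zF ends hsplit hx e he).symm
  have hcap' : ∀ t, t ∈ VH → t ∈ VL → t = a₃ := fun t h1 h2 => hcap t h2 h1
  constructor
  · intro h
    have h' := ((conn_cross ends hsp hcap' ⟨ha3H, ha3L⟩ ha1H hoL hoa3).mp h).1
    exact (conn_side ends hsp hcap' ha1H ha3H).mpr h'
  · intro h
    have h' := ((conn_cross ends hsp hcap' ⟨ha3H, ha3L⟩ ha2H hoL hoa3).mp h).1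
    exact (conn_side ends hsp hcap' ha2H ha3H).mpr h'

/-- **Every typed base vanishes when `a₃` is a cut vertex between `o` and the roots.** -/
theorem typedCount_eq_zero_of_a3_cut {VL VH : Set V} (F : Finset E) (z : Config E) (τ : E → ℕ)
    (hτ : ∀ e ∈ F, τ e = 1 ∨ τ e = 2)
    (hsplit : ∀ e, zF F z e = true → e ∈ within ends VL ∨ e ∈ within ends VH)
    (hcap : ∀ t, t ∈ VL → t ∈ VH → t = a₃) (ha3L : a₃ ∈ VL) (ha3H : a₃ ∈ VH) (hoL : o ∈ VL)
    (ha1H : a₁ ∈ VH) (ha2H : a₂ ∈ VH) (hoa3 : o ≠ a₃) :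
    typedCount F z τ (K3 ends o a₁ a₂ a₃ b : Config E → Config E → Config E → R) = 0 :=
  typedCount_eq_zero_of_oBehindA3 ends o a₁ a₂ a₃ b F z τ hτ
    (OBehindA3.of_cut ends o a₁ a₂ a₃ hsplit hcap ha3L ha3H hoL ha1H ha2H hoa3)

end Pockets

section RootPocket

open Classical

/-- A state has the marks at `a₁` only through `a₂`: a mark at `a₁` forces `a₁ ↔ a₂`. -/
def RootPocketSt (s : St) : Bool := (!s.Lo || s.q') && (!s.Lb || s.q') && (!s.L3 || s.q')

/-- The 16 valid root-pocket states. -/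
def rootPocketStates : List St :=
  [(false, false, false, false, false, false, false),
    (false, false, false, false, false, false, true),
    (false, false, false, false, true, false, false),
    (false, false, false, false, true, false, true),
    (false, false, true, false, false, false, false),
    (false, false, true, false, false, false, true),
    (false, false, true, false, true, false, false),
    (false, false, true, false, true, false, true),
    (true, false, false, false, false, false, false),
    (true, false, false, false, false, true, true),
    (true, false, false, true, true, false, false),
    (true, false, false, true, true, true, true),
    (true, true, true, false, false, false, false),
    (true, true, true, false, false, true, true),
    (true, true, true, true, true, false, false),
    (true, true, true, true, true, true, true)]

/-- Every valid root-pocket state is one of the 16. -/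
theorem mem_rootPocketStates (a b c d e f g : Bool) (h1 : RootPocketSt (a, b, c, d, e, f, g) = true)
    (h2 : ValidQSt (a, b, c, d, e, f, g) = true) (h3 : NoBothSt (a, b, c, d, e, f, g) = true) :
    (a, b, c, d, e, f, g) ∈ rootPocketStates := by
  revert a b c d e f g
  decide +kernel

/-- The symmetrised kernel vanishes on every triple of the 16 states (Boolean form). -/
theorem symKB_eq_zero_all_rootPocket :
    (rootPocketStates.all fun x => rootPocketStates.all fun y => rootPocketStates.all fun w =>
      decide (symKB x y w = 0)) = true := by
  decide +kernel

/-- **The symmetrised kernel vanishes on valid root-pocket triples.** -/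
theorem symKB_eq_zero_rootPocket (x y w : St) (hx : RootPocketSt x = true) (hx' : ValidQSt x = true)
    (hx'' : NoBothSt x = true) (hy : RootPocketSt y = true) (hy' : ValidQSt y = true)
    (hy'' : NoBothSt y = true) (hw : RootPocketSt w = true) (hw' : ValidQSt w = true)
    (hw'' : NoBothSt w = true) : symKB x y w = 0 := by
  have h := symKB_eq_zero_all_rootPocket
  simp only [List.all_eq_true, decide_eq_true_eq] at h
  obtain ⟨a1, b1, c1, d1, e1, f1, g1⟩ := x
  obtain ⟨a2, b2, c2, d2, e2, f2, g2⟩ := y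
  obtain ⟨a3, b3, c3, d3, e3, f3, g3⟩ := w
  exact h _ (mem_rootPocketStates _ _ _ _ _ _ _ hx hx' hx'') _
    (mem_rootPocketStates _ _ _ _ _ _ _ hy hy' hy'') _ (mem_rootPocketStates _ _ _ _ _ _ _ hw hw' hw'')

variable {V : Type*} {E : Type*} [Fintype E] [DecidableEq E] {R : Type*} [Field R]
  [LinearOrder R] [IsStrictOrderedRing R]
variable (ends : E → Sym2 V) (o a₁ a₂ a₃ b : V)

/-- The class: every mark reaches `a₁` only through `a₂`, in every configuration below `z ∪ F`. -/
structure RootPocket (F : Finset E) (z : Config E) : Prop where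
  through : ∀ x : Config E, x ≤ zF F z →
    (Conn ends x a₁ o → Conn ends x a₂ a₁) ∧ (Conn ends x a₁ b → Conn ends x a₂ a₁) ∧
      (Conn ends x a₁ a₃ → Conn ends x a₂ a₁)

omit [Fintype E] [DecidableEq E] in
/-- The state of a root-pocket configuration. -/
lemma rootPocketSt_st {x : Config E}
    (h : (Conn ends x a₁ o → Conn ends x a₂ a₁) ∧ (Conn ends x a₁ b → Conn ends x a₂ a₁) ∧
      (Conn ends x a₁ a₃ → Conn ends x a₂ a₁)) :
    RootPocketSt (st ends o a₁ a₂ a₃ b x) = true := by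
  unfold RootPocketSt st St.q' St.Lo St.Lb St.L3
  simp only [Bool.and_eq_true, Bool.or_eq_true, Bool.not_eq_true', decide_eq_false_iff_not,
    decide_eq_true_eq]
  refine ⟨⟨?_, ?_⟩, ?_⟩
  · by_cases h1 : Conn ends x a₁ o
    · exact Or.inr (h.1 h1)
    · exact Or.inl h1
  · by_cases h1 : Conn ends x a₁ b
    · exact Or.inr (h.2.1 h1)
    · exact Or.inl h1
  · by_cases h1 : Conn ends x a₁ a₃
    · exact Or.inr (h.2.2 h1)
    · exact Or.inl h1

/-- **Every typed base vanishes on a root pocket**: when the marks reach `a₁` only through `a₂`. -/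
theorem typedCount_eq_zero_of_rootPocket (F : Finset E) (z : Config E) (τ : E → ℕ)
    (hτ : ∀ e ∈ F, τ e = 1 ∨ τ e = 2) (h : RootPocket ends o a₁ a₂ a₃ b F z) :
    typedCount F z τ (K3 ends o a₁ a₂ a₃ b : Config E → Config E → Config E → R) = 0 := by
  have h6 := six_mul_typedCount F z τ hτ (K3 ends o a₁ a₂ a₃ b : Config E → Config E → Config E → R)
  have hK : typedCount F z τ (fun x y w =>
      ((symKB (st ends o a₁ a₂ a₃ b x) (st ends o a₁ a₂ a₃ b y) (st ends o a₁ a₂ a₃ b w) : ℤ) : R)) = 0 := by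
    refine typedCount_eq_zero_of_zero_on' F z τ fun x y w hx hy hw => ?_
    rw [symKB_eq_zero_rootPocket _ _ _ (rootPocketSt_st ends o a₁ a₂ a₃ b (h.through x (le_zF hx)))
      (validQSt_st ends o a₁ a₂ a₃ b x) (noBothSt_st ends o a₁ a₂ a₃ b x)
      (rootPocketSt_st ends o a₁ a₂ a₃ b (h.through y (le_zF hy))) (validQSt_st ends o a₁ a₂ a₃ b y)
      (noBothSt_st ends o a₁ a₂ a₃ b y) (rootPocketSt_st ends o a₁ a₂ a₃ b (h.through w (le_zF hw)))
      (validQSt_st ends o a₁ a₂ a₃ b w) (noBothSt_st ends o a₁ a₂ a₃ b w)]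
    simp
  have hsym : typedCount F z τ (fun x y w =>
      ((symKB (st ends o a₁ a₂ a₃ b x) (st ends o a₁ a₂ a₃ b y) (st ends o a₁ a₂ a₃ b w) : ℤ) : R)) =
      typedCount F z τ (fun x y w =>
        (K3 ends o a₁ a₂ a₃ b x y w : R) + K3 ends o a₁ a₂ a₃ b x w y + K3 ends o a₁ a₂ a₃ b y x w +
          K3 ends o a₁ a₂ a₃ b y w x + K3 ends o a₁ a₂ a₃ b w x y + K3 ends o a₁ a₂ a₃ b w y x) := by
    refine typedCount_congr' _ _ _ _ _ fun x y w => ?_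
    simp only [K3_eq_KB]
    unfold symKB
    push_cast
    ring
  have h6' : (6 : R) * typedCount F z τ (K3 ends o a₁ a₂ a₃ b : Config E → Config E → Config E → R) = 0 := by
    rw [h6, ← hsym]
    exact hK
  exact (mul_eq_zero.mp h6').resolve_left (by norm_num)

omit [Fintype E] in
/-- **`a₂` as a cut vertex between `a₁` and the marks** is a root pocket. -/
theorem RootPocket.of_cut {VL VH : Set V} {F : Finset E} {z : Config E}
    (hsplit : ∀ e, zF F z e = true → e ∈ within ends VL ∨ e ∈ within ends VH)
    (hcap : ∀ t, t ∈ VL → t ∈ VH → t = a₂) (ha2L : a₂ ∈ VL) (ha2H : a₂ ∈ VH) (ha1L : a₁ ∈ VL)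
    (hoH : o ∈ VH) (hbH : b ∈ VH) (ha3H : a₃ ∈ VH) (hoa2 : o ≠ a₂) (hba2 : b ≠ a₂)
    (ha3a2 : a₃ ≠ a₂) : RootPocket ends o a₁ a₂ a₃ b F z := by
  refine ⟨fun x hx => ?_⟩
  have hsp : ∀ e, x e = true → e ∈ within ends VL ∨ e ∈ within ends VH :=
    split_of_le_zF ends hsplit hx
  have key : ∀ {u : V}, u ∈ VH → u ≠ a₂ → Conn ends x a₁ u → Conn ends x a₂ a₁ := fun {u} hu hu2 h =>
    conn_symm ((conn_side ends hsp hcap ha1L ha2L).mpr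
      ((conn_cross ends hsp hcap ⟨ha2L, ha2H⟩ ha1L hu hu2).mp h).1)
  exact ⟨key hoH hoa2, key hbH hba2, key ha3H ha3a2⟩

end RootPocket

end RootBridge

end CovForm

end Summit.Ventures.PercRepro2
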